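import Mathlib
import Summits.NavierStokesRegularity.NavierStokesRegularity.Theses.SubOnsagerCeiling
import Literature.Analysis.FluidPDE.Tao2016AveragedNS.SelfSimilarCascadeBlowup
import HarnessLib

/-!
# `SubOnsagerCeiling.ForwardBreakOfCeiling` — a forward-source tail ceiling, cone invariance and
forward-source envelope smoothing give global pseudo-solutions for orthant tables
(item stmt-NavierStokesRegularity-26609; glue with content of route SubOnsagerCeiling rev 2)

**Statement (verbatim route decl).** `ForwardTailCeiling → OrthantInvariance →
ForwardSourceSmoothing → ∀ R ≥ 1, ∀ ε₀ ∈ (0, 1], ∀ α ∈ E₂(R) orthant, ∀ X₀, ¬ NoGlobalCascade ε₀ α X₀`.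

PROOF (the landed `subOnsagerCeiling_breakOfCeiling_proof` of item 25509 with the smoothing ENGINE
replaced by the HYPOTHESIS `ForwardSourceSmoothing` and the total tails by the `S`-tails). Fix
`R ≥ 1`, `ε₀ ∈ (0,1]`, an orthant table `α ∈ E₂(R)`, a datum `X₀`; suppose `NoGlobalCascade ε₀ α X₀`;
the κ-normal form (`noGlobalCascade_iff_kappa`) gives a defect level `κ > 0` with no global
pseudo-solution. `ForwardTailCeiling` supplies a source set `S` (`i ∉ S ⇒ α i j l (0,0,1) = 0`),
`θ > 1/2` and `C ≥ 0` with `Σ_{k=n}^{N} Σ_{i∈S} ½X_{i,k}(t)² ≤ C·E₀·(1+ε₀)^{−2θn}` for every honest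
`ν`-viscous solution non-negative on shells `≥ 1`; `OrthantInvariance` gives that sign. With
`η := 2θ − 1 > 0` this is the `S`-envelope hypothesis of `ForwardSourceSmoothing` at `ν = κ/√2`
(constant `C·E₀`, the same for every horizon), which yields a global regular viscous solution, hence
a global `(κ, κ)`-pseudo-solution (`hasGlobal_of_viscousGlobal`, `hasGlobal_mono`) — contradiction.

HONEST FRAMING: statements about Tao-type MODEL lattice ODEs (route SubOnsagerCeiling, rung
TL-M2Break); `ForwardTailCeiling` is the route's OPEN crux and stays a hypothesis (as does
`ForwardSourceSmoothing` here, although it is proved in the tree as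
`Theorems.forwardSourceSmoothing_proof` for the byte-identical decl of route OrthantWake); nothing
bears on Navier–Stokes regularity and no summit is proved.
-/

noncomputable section

-- the sub-problem namespace `NavierStokesRegularity.NavierStokesRegularity` is the tree's layout (D-0017)
set_option linter.dupNamespace false

namespace Summit.NavierStokesRegularity.NavierStokesRegularity.Theorems

open Set Filter
open scoped Topology
open Literature.Analysis.FluidPDE.TaoCascade

/-- **Item stmt-NavierStokesRegularity-26609** (`SubOnsagerCeiling.ForwardBreakOfCeiling`): a
`θ > 1/2` ceiling on the forward-source tails of the non-negative honest viscous solutions of an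
orthant table (`ForwardTailCeiling`), Kamke cone invariance (`OrthantInvariance`) and forward-source
envelope smoothing (`ForwardSourceSmoothing`) imply, for every `R ≥ 1`, every scale ratio
`1 + ε₀ ∈ (1, 2]` and every orthant table of `E₂(R)`, the negation of `NoGlobalCascade` from every
one-shell datum (the `S`-envelope with `η = 2θ − 1` and horizon-independent constant `C·E₀`).
MODEL lattice statement; no Navier–Stokes statement is proved. [this file] -/
theorem subOnsagerCeiling_forwardBreakOfCeiling_proof :
    Summit.NavierStokesRegularity.NavierStokesRegularity.Theses.SubOnsagerCeiling.ForwardBreakOfCeiling := by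
  unfold Summit.NavierStokesRegularity.NavierStokesRegularity.Theses.SubOnsagerCeiling.ForwardBreakOfCeiling
    Summit.NavierStokesRegularity.NavierStokesRegularity.Theses.SubOnsagerCeiling.ForwardTailCeiling
    Summit.NavierStokesRegularity.NavierStokesRegularity.Theses.SubOnsagerCeiling.OrthantInvariance
    Summit.NavierStokesRegularity.NavierStokesRegularity.Theses.SubOnsagerCeiling.ForwardSourceSmoothing
  intro hC hI hB R hR ε₀ hε₀ hε1 α X₀ hα hK hNG
  obtain ⟨κ, hκ, hno⟩ := (noGlobalCascade_iff_kappa hε₀).1 hNG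
  have h2 : 0 < Real.sqrt 2 := Real.sqrt_pos.2 two_pos
  have hν : 0 < κ / Real.sqrt 2 := div_pos hκ h2
  -- the forward-source ceiling of the orthant table `α` at scale ratio `1 + ε₀`
  obtain ⟨S, hS, θ, hθ, C, _hC0, H⟩ := hC R hR ε₀ hε₀ hε1 α hα hK
  -- the subcritical envelope exponent `η = 2θ - 1 > 0`
  have hη : 0 < 2 * θ - 1 := by linarith
  obtain ⟨X, hX⟩ := hB ε₀ (2 * θ - 1) R hε₀ hη α hα S hS X₀ (κ / Real.sqrt 2) hν
    (fun T _hT => ⟨C * (∑ i : Fin 4, (1 / 2 : ℝ) * X₀ i ^ 2),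
      fun s hs Y hinit hlow hbd hcont hder n N hnN t ht => by
        have hnonneg := hI ε₀ (κ / Real.sqrt 2) hε₀ hν α hK X₀ s hs.1 Y hinit hlow hbd hcont hder
        have hceil := H (κ / Real.sqrt 2) hν X₀ s hs.1 Y hinit hlow hbd hcont hder hnonneg n N hnN
          t ht
        have hexp : -((1 + (2 * θ - 1)) * (n : ℝ)) = -(2 * θ * (n : ℝ)) := by ring
        rw [hexp]
        exact hceil⟩)
  have hG := hasGlobal_of_viscousGlobal hε₀ hν.le hX
  rw [div_mul_cancel₀ κ h2.ne'] at hG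
  exact hno (hasGlobal_mono hε₀.le hG le_rfl hκ.le)

end Summit.NavierStokesRegularity.NavierStokesRegularity.Theorems

end
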